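import Literature.MathematicalPhysics.QuantumFieldTheory.Balaban1983to89.Node00.LargeFieldBackgroundCoPOfRecord
import Literature.MathematicalPhysics.QuantumFieldTheory.Balaban1983to89.Node00.LargeFieldBackgroundCoOfRecordFaces

/-!
# NODE 00 (definitions of record, R-side ₇, FILE 22′b) — the `Ω₁ = ∅` step-zero faces of the SUPPORT edition (FILE 22′ v1.5 `CoP`,
# `Node00/LargeFieldBackgroundCoPOfRecord`), announced in its header as «a later theorem-only leaf»; theorem-only, no new notion

§0 HELPERS (kernel bookkeeping): `topSeq_congr_of_agree` (two sequences agreeing on the scales `1 … k` have the same support-topped sequences up to `k`),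
`pts_emptySet`, `genSet_top_eq_empty` (`Γ_k = Ω_k^{(k)} = ∅` when `Ω_k = ∅`, (2.2)).

§1 THE SUPPORT OF RECORD AT `Ω₁ = ∅`: `suppDomOfRecord_of_Omega_empty` — `Ω₀(s) = (Ω₁)^{∼M₁·1} = ∅` (print [15] (3): no large-field region, no
collar; the `hullD` of the empty region is empty — cf. `hullD_empty` of `Node00/StepWeightsAtNoExpansion`, deliberately NOT imported here: that module's
import closure carries the B6∕B8∕B9 towers and `Node00.Record13`, which a FILE 22′ leaf must not pull in).

§2 THE STRUCTURE FACES OF THE CLASS ON A SUPPORT `regMSCoPOfRecordAt` ∕ OF RECORD `regMSCoPOfRecord` ([6] (1.7) ∧ (1.9) ranged by [15] (2)–(3)):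
`regMSCoPOfRecordAt_zero_eq` (length 0: (1.7) on the plaquettes of the support `Ω₀` at `εreg·η₀²` ∧ (1.9) on the bonds of `Ω₀` at `εreg·η₀³`),
`regMSCoPOfRecordAt_succ_eq_of_Omega_empty` (a no-expansion step `Ω_{k+1} = ∅` adds only vacuous clauses; generic in the two sequences and the support),
`mem_regMSCoPOfRecordAt_one_iff_of_Omega_empty` (base case `k = 1`, `Ω₁ = ∅`, generic support), `regMSCoPOfRecordAt_empty_one_eq_univ_of_Omega_empty`,
`regMSCoPOfRecord_succ_eq_of_Omega_empty` (of-record arity, `k ≥ 1`: the support reads only `Ω₁`, on which the two sequences agree) and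
**`regMSCoPOfRecord_one_eq_univ_of_Omega_empty`**: AT `Ω₁ = ∅` THE CLASS OF RECORD IS EVERYTHING — the support is empty, so NO clause is posed on the
scale-`0` field (print: with no small-field region there is no variational problem and no regularity demand at step zero).  DELTA against FILE 22's
`Ω₀ = T_η` edition (`mem_regMSCoOfRecord_one_iff_of_Omega_empty`: GLOBAL (1.7) ∧ GLOBAL (1.9)) and FILE 16's (1.7)-edition (GLOBAL (1.7)).

§3 THE SUPPORT-EDITION BACKGROUND OF RECORD `UbgMSCoPOfRecord` AT A LENGTH-1 SEQUENCE WITH `Ω₁ = ∅`: by n11's generic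
`isMinimizer_genSet_one_iff_of_Omega_empty` (`Node00/TkNoExpansionStepZero`) the (2.12) constraint set there is the singleton `{𝐖 0}` and by §2 the class
is everything, so the solvable set is ALL of `MSField` (`solvableDom_regMSCoP_genSet_one_eq_univ_of_Omega_empty`) and
**`UbgMSCoPOfRecord_one_of_Omega_empty`: `U_1(s)(𝐖) = 𝐖 0` UNCONDITIONALLY** — print's `U₁ = V₀` on `Γ₀ = T` with NO regularity hypothesis on the datum
(the located junk event of the `T_η`-posed editions — FILE 16 `UbgMSOfRecord_one_of_Omega_empty_of_not`, FILE 22b `UbgMSCoOfRecord_one_of_Omega_empty_of_not`: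
the unit configuration for an irregular `𝐖 0` — does not occur in the support edition: `UbgMSCoPOfRecord_one_of_Omega_empty_of_not_mem_Co`).  Generic-support
forms `mem_solvableDom_regMSCoPAt_genSet_one_iff_of_Omega_empty`, `UbgMSCoPOfRecordAt_one_of_Omega_empty[_of_mem|_of_not_mem]`; junctions with the older
editions where those return the datum: `UbgMSCoOfRecord_one_eq_UbgMSCoPOfRecord_one_of_Omega_empty_of_mem`, `UbgMSOfRecord_one_eq_UbgMSCoPOfRecord_one_of_Omega_empty`.

§4 THE RANGED DATA ENVELOPE `regSuppPOfRecord` (FILE 22′ §5): `one_mem_regSuppPOfRecord` ∕ `regSuppPOfRecord_nonempty` (at print's sign the unit multiscale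
configuration is retained — FILE 13's `one_mem_regSuppOfRecord` for the ranged envelope; asked by name by node00-def-T, pub-ymgap INBOX 2026-08-27 l.18490,
who meanwhile proved the instance it needed locally in `Node00/Record13CoP`), and `regSuppPOfRecord_one_eq_univ_of_Omega_empty` (length 1, `Ω₁ = ∅`: collar
`∅ ∖ ∅` and `Γ₁ = ∅` — the envelope is everything, for ANY sign of the letter `cR`).

§5 THE LOCATED DEGENERATE INSTANCE `M₁ = 0` OF THE LETTER `ν.M₁` (self-located by node00-def-P11 g3, pub-ymgap INBOX 2026-08-27 l.18760, probe
`ProbeEmptySupport` — «no ask» to def-R; documented here on def-R's own objects, definitions NOT edited): `cubeIndices_side_zero` (FILE 1: no cube of side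
`0`), `suppDomOfRecord_of_M₁_eq_zero` (the support of record is EMPTY for every sequence — [15] p. 277 (1) «Ω₀ ⊇ Ω₁» fails there; print's `M₁ ≥ 1`,
[6] (1.3)–(1.6), excludes the instance and the record's `θ` has `M₁ ∣ M = L^a`, fields `hM₁`∕`hM` of def-T's `Stage13Params.Provisos₁₃SepCoP`, whence `M₁ ≠ 0` there by `F.hL.2 : 1 < L`, Mathlib's `pow_ne_zero` and
`ne_zero_of_dvd_ne_zero` — ref-H READ-195+193 ADDENDUM, pub-ymgap INBOX l.18873, concurs), `mem_regMSCoPOfRecordAt_empty_iff` (the class on the empty support = the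
positive-scale clauses only), `regMSCoPOfRecord_eq_At_empty_of_M₁_eq_zero` ∕ `mem_regMSCoPOfRecord_iff_of_M₁_eq_zero` (at `M₁ = 0` the class of record poses
no scale-`0` clause, for every `k`), `mem_regSuppPOfRecord_iff_of_M₁_eq_zero` (no collar clause).  The guard `0 < ν.M₁` lives on the consumers' facts
(def-P11's `…Top7M ∕ …CoP7M`), not in these definitions.

Bookkeeping over landed definitions; nothing of Bałaban asserted ([15] Thm 1 existence NOT used: at `Ω₁ = ∅` the minimiser is forced).  Honest framing: finite
`𝕋⁴` at fixed `ε`; no continuum ∕ OS ∕ mass-gap ∕ Clay content; counts unmoved.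
[cite: Balaban1985RegularSpaces, (1.3)–(1.6),(1.7),(1.9) p.77; Balaban1985Variational, (1) p.277, (2),(3),(6) p.278, Thm 1 (8) p.279; Balaban1988Convergent, (2.2) p.255, (2.10)–(2.13) pp.256–257, (2.17) p.257]
-/

noncomputable section

namespace Literature.MathematicalPhysics.QuantumFieldTheory.Balaban1983to89.Node00

open Literature.MathematicalPhysics.QuantumFieldTheory.Balaban1983to89
open T4Continuum B15DeterminingSets

section Helpers

variable {P : Params}

/-- Two sequences of regions agreeing on the scales `1 … k` have the same support-topped sequences up to scale `k` (same top `Ω₀`).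
[cite: Balaban1988Convergent, p.255 (bookkeeping)] -/
theorem topSeq_congr_of_agree (Ω₀ : Set (Site P 0)) {Ω Ω' : ℕ → Set (Site P 0)} {k : ℕ} (hagree : ∀ j, 1 ≤ j → j ≤ k → Ω' j = Ω j)
    {j : ℕ} (hj : j ≤ k) : topSeq Ω₀ Ω' j = topSeq Ω₀ Ω j := by
  rcases Nat.eq_zero_or_pos j with rfl | hpos
  · rfl
  · rw [topSeq_of_ne_zero Ω₀ Ω' hpos.ne', topSeq_of_ne_zero Ω₀ Ω hpos.ne', hagree j hpos hj]

/-- `∅^{(j)} = ∅` (preimage of the empty region; definitional). [cite: Balaban1987RG1, (0.1) p.251 (bookkeeping)] -/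
theorem pts_emptySet (j : ℕ) : pts j (∅ : Set (Site P 0)) = (∅ : Set (Site P j)) := rfl

/-- `Γ_k = Ω_k^{(k)}` is empty when `Ω_k = ∅` ((2.2), top member). [cite: Balaban1988Convergent, (2.2) p.255 (bookkeeping)] -/
theorem genSet_top_eq_empty (Ω : ℕ → Set (Site P 0)) {k : ℕ} (h : Ω k = ∅) : genSet Ω k k = ∅ := by
  show pts k (gammaRegion Ω k k) = ∅
  rw [gammaRegion_self, h, pts_emptySet]

end Helpers

variable (F : T4Family) (N : ℕ) [NeZero N]

/-! ## §1  The support of record at `Ω₁ = ∅` -/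

open Classical in
/-- **NO SMALL-FIELD REGION, NO SUPPORT**: at `Ω₁ = ∅` the support of record `Ω₀(s) = (Ω₁)^{∼M₁}` is empty ([15] (3) «Λ₀ ⊆ Ω₀ ∖ Ω₁»: nothing to
enlarge; the `hullD` of the empty region has no contributing cube — cf. `hullD_empty`, `Node00/StepWeightsAtNoExpansion`, not imported).
[cite: Balaban1985Variational, (3) p.278; Balaban1988Convergent, p.255, p.264–265 (bookkeeping)] -/
theorem suppDomOfRecord_of_Omega_empty (ν : Stage7Numerics) (K : ℕ) {Ω : ℕ → Set (Site (F.P K) 0)} (hΩ : Ω 1 = ∅) :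
    suppDomOfRecord F ν K Ω = ∅ := by
  rw [suppDomOfRecord_eq, hΩ]
  refine Set.eq_empty_of_forall_notMem fun x hx => ?_
  unfold hullD at hx
  obtain ⟨a, ha, -⟩ := Set.mem_iUnion₂.1 hx
  obtain ⟨y, -, hy⟩ := (Finset.mem_filter.1 ha).2
  exact hy

/-! ## §2  The structure faces of the class on a support ∕ of record -/

/-- **LENGTH 0**: the class on a support `Ω₀` at `k = 0` is (1.7) on the plaquettes of `Ω₀` at `εreg·η₀²` together with (1.9) on the bonds of `Ω₀` at
`εreg·η₀³` (the support-topped sequence at scale `0` is `Ω₀`). [cite: Balaban1985RegularSpaces, (1.7),(1.9) p.77 (j = 0); Balaban1985Variational, (2),(3) p.278] -/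
theorem regMSCoPOfRecordAt_zero_eq (ν : Stage7Numerics) (K : ℕ) (Ω₀ : Set (Site (F.P K) 0)) (Ω : ℕ → Set (Site (F.P K) 0)) :
    regMSCoPOfRecordAt F N ν K 0 Ω₀ Ω =
      {U | PlaqSmallOn (B8Eq17ClassAkV1.plaqsOf Ω₀) (ν.εreg * (F.P K).eta 0 ^ 2) U ∧
        Sect2.CoDivSmallOn (bondsOf Ω₀) (ν.εreg * (F.P K).eta 0 ^ 3) U} := by
  ext U
  simp only [regMSCoPOfRecordAt_eq_setOf, Set.mem_setOf_eq]
  constructor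
  · rintro ⟨h7, h9⟩
    exact ⟨by simpa only [topSeq_zero] using h7 0 le_rfl, by simpa only [topSeq_zero] using h9 0 le_rfl⟩
  · rintro ⟨h7, h9⟩
    refine ⟨fun j hj => ?_, fun j hj => ?_⟩
    · obtain rfl := Nat.le_zero.mp hj
      simpa only [topSeq_zero] using h7
    · obtain rfl := Nat.le_zero.mp hj
      simpa only [topSeq_zero] using h9

variable {F N}

/-- **A NO-EXPANSION STEP ADDS ONLY VACUOUS CLAUSES** (support reading): if `Ω_{k+1} = ∅` and `Ω'` agrees with `Ω` on the scales `1 … k`, the class of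
length `k+1` for `Ω` on a support `Ω₀` is the length-`k` class for `Ω'` on the same support (FILE 22b `regMSCoOfRecord_succ_eq_of_Omega_empty` shape;
n11's `s.init` instance is one application). [cite: Balaban1985RegularSpaces, (1.7),(1.9) p.77; Balaban1988Convergent, (2.12) p.256] -/
theorem regMSCoPOfRecordAt_succ_eq_of_Omega_empty (ν : Stage7Numerics) (K k : ℕ) (Ω₀ : Set (Site (F.P K) 0)) {Ω Ω' : ℕ → Set (Site (F.P K) 0)}
    (hΩ : Ω (k + 1) = ∅) (hagree : ∀ j, 1 ≤ j → j ≤ k → Ω' j = Ω j) :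
    regMSCoPOfRecordAt F N ν K (k + 1) Ω₀ Ω = regMSCoPOfRecordAt F N ν K k Ω₀ Ω' := by
  have hT : ∀ j, j ≤ k → topSeq Ω₀ Ω' j = topSeq Ω₀ Ω j := fun j hj => topSeq_congr_of_agree Ω₀ hagree hj
  ext U
  simp only [regMSCoPOfRecordAt_eq_setOf, Set.mem_setOf_eq]
  constructor
  · rintro ⟨h7, h9⟩
    exact ⟨fun j hj => hT j hj ▸ h7 j (Nat.le_succ_of_le hj), fun j hj => hT j hj ▸ h9 j (Nat.le_succ_of_le hj)⟩
  · rintro ⟨h7, h9⟩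
    refine ⟨fun j hj => ?_, fun j hj => ?_⟩
    · rcases Nat.of_le_succ hj with hle | rfl
      · exact hT j hle ▸ h7 j hle
      · rw [topSeq_succ, hΩ, plaqsOf_empty]; exact plaqSmallOn_empty _ _
    · rcases Nat.of_le_succ hj with hle | rfl
      · exact hT j hle ▸ h9 j hle
      · rw [topSeq_succ, hΩ, bondsOf_empty]; exact coDivSmallOn_empty _ _

/-- **THE BASE CASE `k = 1`, `Ω₁ = ∅`, ON A SUPPORT `Ω₀`**: (1.7) on the plaquettes of `Ω₀` at `εreg·η₀²` ∧ (1.9) on the bonds of `Ω₀` at `εreg·η₀³` — and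
nothing else. [cite: Balaban1985RegularSpaces, (1.7),(1.9) p.77 (j = 0); Balaban1985Variational, (2),(3) p.278] -/
theorem mem_regMSCoPOfRecordAt_one_iff_of_Omega_empty (ν : Stage7Numerics) (K : ℕ) (Ω₀ : Set (Site (F.P K) 0)) (Ω : ℕ → Set (Site (F.P K) 0))
    (hΩ : Ω 1 = ∅) (U : GaugeField (F.P K) 0 (SU N)) :
    U ∈ regMSCoPOfRecordAt F N ν K 1 Ω₀ Ω ↔
      PlaqSmallOn (B8Eq17ClassAkV1.plaqsOf Ω₀) (ν.εreg * (F.P K).eta 0 ^ 2) U ∧ Sect2.CoDivSmallOn (bondsOf Ω₀) (ν.εreg * (F.P K).eta 0 ^ 3) U := by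
  rw [regMSCoPOfRecordAt_succ_eq_of_Omega_empty ν K 0 Ω₀ (Ω := Ω) (Ω' := Ω) hΩ (fun _ _ _ => rfl), regMSCoPOfRecordAt_zero_eq]
  exact Iff.rfl

/-- On the EMPTY support the length-`1` class at `Ω₁ = ∅` is everything (both clauses range over empty families).
[cite: Balaban1985RegularSpaces, (1.7),(1.9) p.77; Balaban1985Variational, (3) p.278 (bookkeeping)] -/
theorem regMSCoPOfRecordAt_empty_one_eq_univ_of_Omega_empty (ν : Stage7Numerics) (K : ℕ) (Ω : ℕ → Set (Site (F.P K) 0)) (hΩ : Ω 1 = ∅) :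
    regMSCoPOfRecordAt F N ν K 1 ∅ Ω = Set.univ :=
  Set.eq_univ_of_forall fun U => (mem_regMSCoPOfRecordAt_one_iff_of_Omega_empty ν K ∅ Ω hΩ U).2
    ⟨by rw [plaqsOf_empty]; exact plaqSmallOn_empty _ _, by rw [bondsOf_empty]; exact coDivSmallOn_empty _ _⟩

/-- **A NO-EXPANSION STEP, OF-RECORD ARITY** (`k ≥ 1`): the support of record reads only `Ω₁`, on which the two sequences agree, so FILE 22b's face transports
verbatim to the support edition. [cite: Balaban1985RegularSpaces, (1.7),(1.9) p.77; Balaban1988Convergent, p.255, (2.12) p.256] -/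
theorem regMSCoPOfRecord_succ_eq_of_Omega_empty (ν : Stage7Numerics) (K : ℕ) {k : ℕ} (hk : 1 ≤ k) {Ω Ω' : ℕ → Set (Site (F.P K) 0)}
    (hΩ : Ω (k + 1) = ∅) (hagree : ∀ j, 1 ≤ j → j ≤ k → Ω' j = Ω j) :
    regMSCoPOfRecord F N ν K (k + 1) Ω = regMSCoPOfRecord F N ν K k Ω' := by
  rw [regMSCoPOfRecord_eq_At, regMSCoPOfRecord_eq_At, suppDomOfRecord_congr F ν K (hagree 1 le_rfl hk).symm,
    regMSCoPOfRecordAt_succ_eq_of_Omega_empty ν K k _ hΩ hagree]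

/-- **AT `Ω₁ = ∅` THE CLASS OF RECORD IS EVERYTHING**: the support of record is empty (§1), so the support edition poses NO clause on the scale-`0` field —
print's situation (no small-field region ⇒ no variational problem, no regularity demand at step zero).  DELTA: FILE 22's `T_η`-posed class there is GLOBAL
(1.7) ∧ GLOBAL (1.9) (`mem_regMSCoOfRecord_one_iff_of_Omega_empty`), FILE 16's is GLOBAL (1.7).
[cite: Balaban1985Variational, (2),(3) p.278; Balaban1985RegularSpaces, (1.7),(1.9) p.77; Balaban1988Convergent, (2.12) p.256] -/
theorem regMSCoPOfRecord_one_eq_univ_of_Omega_empty (ν : Stage7Numerics) (K : ℕ) (Ω : ℕ → Set (Site (F.P K) 0)) (hΩ : Ω 1 = ∅) :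
    regMSCoPOfRecord F N ν K 1 Ω = Set.univ := by
  rw [regMSCoPOfRecord_eq_At, suppDomOfRecord_of_Omega_empty F ν K hΩ, regMSCoPOfRecordAt_empty_one_eq_univ_of_Omega_empty ν K Ω hΩ]

/-- Membership form of the same face: every scale-`0` field is in the class of record at `Ω₁ = ∅`. [cite: Balaban1985Variational, (2),(3) p.278 (bookkeeping)] -/
theorem mem_regMSCoPOfRecord_one_of_Omega_empty (ν : Stage7Numerics) (K : ℕ) (Ω : ℕ → Set (Site (F.P K) 0)) (hΩ : Ω 1 = ∅)
    (U : GaugeField (F.P K) 0 (SU N)) : U ∈ regMSCoPOfRecord F N ν K 1 Ω := by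
  rw [regMSCoPOfRecord_one_eq_univ_of_Omega_empty ν K Ω hΩ]; exact Set.mem_univ U

/-! ## §3  The support-edition background of record at the all-large-field sequence -/

section BackgroundAtAllLarge

/-- **THE SOLVABLE SET ON A SUPPORT AT `Ω₁ = ∅`, READ AT THE DATUM**: the (2.12) constraint set is the singleton `{𝐖 0}` (n11's
`isMinimizer_genSet_one_iff_of_Omega_empty`), so a minimal configuration over the class on `Ω₀` exists iff `𝐖 0` lies in that class.
[cite: Balaban1988Convergent, (2.2) p.255, (2.12) p.256; Balaban1985Variational, (6) p.278] -/
theorem mem_solvableDom_regMSCoPAt_genSet_one_iff_of_Omega_empty (ν : Stage7Numerics) (K : ℕ) (Ω₀ : Set (Site (F.P K) 0)) (Ω : ℕ → Set (Site (F.P K) 0))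
    (hΩ : Ω 1 = ∅) (W : MSField (F.P K) (SU N)) :
    W ∈ solvableDom (avOfRecord F N K) (regMSCoPOfRecordAt F N ν K 1 Ω₀ Ω) (genSet Ω 1) ↔ W 0 ∈ regMSCoPOfRecordAt F N ν K 1 Ω₀ Ω := by
  rw [mem_solvableDom_iff]
  constructor
  · rintro ⟨U₀, hU₀⟩
    exact ((isMinimizer_genSet_one_iff_of_Omega_empty _ _ Ω hΩ W U₀).1 hU₀).2
  · intro h
    exact ⟨W 0, (isMinimizer_genSet_one_iff_of_Omega_empty _ _ Ω hΩ W (W 0)).2 ⟨rfl, h⟩⟩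

/-- **OF RECORD, EVERY RETAINED CONFIGURATION IS SOLVABLE AT `Ω₁ = ∅`** (membership form): the class of record is everything (§2) and `𝐖 0` is its own
minimiser. [cite: Balaban1988Convergent, (2.12) p.256; Balaban1985Variational, (3),(6) p.278] -/
theorem mem_solvableDom_regMSCoP_genSet_one_of_Omega_empty (ν : Stage7Numerics) (K : ℕ) (Ω : ℕ → Set (Site (F.P K) 0)) (hΩ : Ω 1 = ∅)
    (W : MSField (F.P K) (SU N)) : W ∈ solvableDom (avOfRecord F N K) (regMSCoPOfRecord F N ν K 1 Ω) (genSet Ω 1) := by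
  rw [mem_solvableDom_iff]
  exact ⟨W 0, (isMinimizer_genSet_one_iff_of_Omega_empty _ _ Ω hΩ W (W 0)).2 ⟨rfl, mem_regMSCoPOfRecord_one_of_Omega_empty ν K Ω hΩ _⟩⟩

/-- … set form: the solvable set of record at `Ω₁ = ∅` is all of `MSField`. [cite: Balaban1988Convergent, (2.12) p.256 (bookkeeping)] -/
theorem solvableDom_regMSCoP_genSet_one_eq_univ_of_Omega_empty (ν : Stage7Numerics) (K : ℕ) (Ω : ℕ → Set (Site (F.P K) 0)) (hΩ : Ω 1 = ∅) :
    solvableDom (avOfRecord F N K) (regMSCoPOfRecord F N ν K 1 Ω) (genSet Ω 1) = Set.univ :=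
  Set.eq_univ_of_forall fun W => mem_solvableDom_regMSCoP_genSet_one_of_Omega_empty ν K Ω hΩ W

/-- **def-R's SUPPORT-EDITION BACKGROUND OF RECORD AT THE ALL-LARGE-FIELD SEQUENCE IS THE FINE FIELD — UNCONDITIONALLY**: at `Ω₁(s) = ∅`,
`U_1(s)(𝐖) = 𝐖 0` for EVERY retained configuration `𝐖` — print's `U₁ = V₀` on `Γ₀ = T` with no regularity hypothesis on the datum (the support is empty, the
class is everything, the constraint set is `{𝐖 0}`; no minimisation is left, so [15] Thm 1 is not invoked).  The located junk event of the `T_η`-posed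
editions (unit configuration for an irregular `𝐖 0`) does not occur here. [cite: Balaban1988Convergent, (2.12)–(2.13) pp.256–257; Balaban1985Variational, (3) p.278, Thm 1 (8) p.279] -/
theorem UbgMSCoPOfRecord_one_of_Omega_empty (ν : Stage7Numerics) (M : ℕ) (g : ℕ → ℝ) (K : ℕ) (s : SeqOfRecord F ν M g K 1) (hΩ : s.Ω 1 = ∅)
    (W : MSField (F.P K) (SU N)) : UbgMSCoPOfRecord F N ν M g K 1 s W = W 0 := by
  have hex : ∃ U₀, IsMinimizer (avOfRecord F N K) (regMSCoPOfRecord F N ν K 1 s.Ω) (genSet s.Ω 1) W U₀ :=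
    ⟨W 0, (isMinimizer_genSet_one_iff_of_Omega_empty _ _ s.Ω hΩ W (W 0)).2 ⟨rfl, mem_regMSCoPOfRecord_one_of_Omega_empty ν K s.Ω hΩ _⟩⟩
  rw [UbgMSCoPOfRecord_apply]
  exact ((isMinimizer_genSet_one_iff_of_Omega_empty _ _ s.Ω hΩ W _).1
    (isMinimizer_UminOfRecord (avOfRecord F N K) (regMSCoPOfRecord F N ν K 1 s.Ω) hex)).1

/-- **ON A SUPPORT `Ω₀`** (membership form): at `Ω₁(s) = ∅`, `U_1(s)(𝐖) = 𝐖 0` whenever `𝐖 0` lies in the class on `Ω₀`.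
[cite: Balaban1988Convergent, (2.12)–(2.13) pp.256–257; Balaban1985Variational, Thm 1 (8) p.279] -/
theorem UbgMSCoPOfRecordAt_one_of_Omega_empty_of_mem (ν : Stage7Numerics) (M : ℕ) (g : ℕ → ℝ) (K : ℕ) (Ω₀ : Set (Site (F.P K) 0))
    (s : SeqOfRecord F ν M g K 1) (hΩ : s.Ω 1 = ∅) (W : MSField (F.P K) (SU N)) (hW : W 0 ∈ regMSCoPOfRecordAt F N ν K 1 Ω₀ s.Ω) :
    UbgMSCoPOfRecordAt F N ν M g K 1 Ω₀ s W = W 0 := by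
  have hex : ∃ U₀, IsMinimizer (avOfRecord F N K) (regMSCoPOfRecordAt F N ν K 1 Ω₀ s.Ω) (genSet s.Ω 1) W U₀ :=
    ⟨W 0, (isMinimizer_genSet_one_iff_of_Omega_empty _ _ s.Ω hΩ W (W 0)).2 ⟨rfl, hW⟩⟩
  rw [UbgMSCoPOfRecordAt_apply]
  exact ((isMinimizer_genSet_one_iff_of_Omega_empty _ _ s.Ω hΩ W _).1
    (isMinimizer_UminOfRecord (avOfRecord F N K) (regMSCoPOfRecordAt F N ν K 1 Ω₀ s.Ω) hex)).1

/-- **… WITH THE CLASS DISPLAYED**: (1.7) on the plaquettes of `Ω₀` at `εreg·η₀²` ∧ (1.9) on the bonds of `Ω₀` at `εreg·η₀³`, read at `𝐖 0`.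
[cite: Balaban1985RegularSpaces, (1.7),(1.9) p.77 (j = 0); Balaban1988Convergent, (2.12) p.256] -/
theorem UbgMSCoPOfRecordAt_one_of_Omega_empty (ν : Stage7Numerics) (M : ℕ) (g : ℕ → ℝ) (K : ℕ) (Ω₀ : Set (Site (F.P K) 0))
    (s : SeqOfRecord F ν M g K 1) (hΩ : s.Ω 1 = ∅) (W : MSField (F.P K) (SU N))
    (hW7 : PlaqSmallOn (B8Eq17ClassAkV1.plaqsOf Ω₀) (ν.εreg * (F.P K).eta 0 ^ 2) (W 0))
    (hW9 : Sect2.CoDivSmallOn (bondsOf Ω₀) (ν.εreg * (F.P K).eta 0 ^ 3) (W 0)) : UbgMSCoPOfRecordAt F N ν M g K 1 Ω₀ s W = W 0 :=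
  UbgMSCoPOfRecordAt_one_of_Omega_empty_of_mem ν M g K Ω₀ s hΩ W ((mem_regMSCoPOfRecordAt_one_iff_of_Omega_empty ν K Ω₀ s.Ω hΩ _).2 ⟨hW7, hW9⟩)

/-- … and OFF the class on `Ω₀` at the datum it is the junk unit configuration (the solvable set is empty there: FILE 1's totalisation).
[cite: Balaban1988Convergent, (2.12) p.256 (typing convention)] -/
theorem UbgMSCoPOfRecordAt_one_of_Omega_empty_of_not_mem (ν : Stage7Numerics) (M : ℕ) (g : ℕ → ℝ) (K : ℕ) (Ω₀ : Set (Site (F.P K) 0))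
    (s : SeqOfRecord F ν M g K 1) (hΩ : s.Ω 1 = ∅) (W : MSField (F.P K) (SU N)) (hW : W 0 ∉ regMSCoPOfRecordAt F N ν K 1 Ω₀ s.Ω) :
    UbgMSCoPOfRecordAt F N ν M g K 1 Ω₀ s W = fun _ => 1 :=
  UbgMSCoPOfRecordAt_of_not_mem ν M g K 1 Ω₀ s (by rwa [mem_solvableDom_regMSCoPAt_genSet_one_iff_of_Omega_empty ν K Ω₀ s.Ω hΩ])

/-- **THE LOCATED JUNK EVENT OF THE `T_η`-POSED EDITION DOES NOT OCCUR IN THE SUPPORT EDITION**: where FILE 22's full-class background returns the unit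
configuration at `Ω₁ = ∅` (an irregular `𝐖 0`), the support edition still returns the datum.
[cite: Balaban1988Convergent, (2.12) p.256 (typing convention); Balaban1985Variational, (3) p.278] -/
theorem UbgMSCoPOfRecord_one_of_Omega_empty_of_not_mem_Co (ν : Stage7Numerics) (M : ℕ) (g : ℕ → ℝ) (K : ℕ) (s : SeqOfRecord F ν M g K 1)
    (hΩ : s.Ω 1 = ∅) (W : MSField (F.P K) (SU N)) (hW : W 0 ∉ regMSCoOfRecord F N ν K 1 s.Ω) :
    UbgMSCoOfRecord F N ν M g K 1 s W = (fun _ => 1) ∧ UbgMSCoPOfRecord F N ν M g K 1 s W = W 0 :=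
  ⟨UbgMSCoOfRecord_one_of_Omega_empty_of_not_mem ν M g K s hΩ W hW, UbgMSCoPOfRecord_one_of_Omega_empty ν M g K s hΩ W⟩

/-- Junction with FILE 22's full-class edition at `Ω₁ = ∅`: where that one returns the datum (`𝐖 0` in the `T_η`-posed full class), the two backgrounds agree.
[cite: Balaban1985RegularSpaces, (1.7),(1.9) p.77; Balaban1988Convergent, (2.12) p.256] -/
theorem UbgMSCoOfRecord_one_eq_UbgMSCoPOfRecord_one_of_Omega_empty_of_mem (ν : Stage7Numerics) (M : ℕ) (g : ℕ → ℝ) (K : ℕ) (s : SeqOfRecord F ν M g K 1)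
    (hΩ : s.Ω 1 = ∅) (W : MSField (F.P K) (SU N)) (hW : W 0 ∈ regMSCoOfRecord F N ν K 1 s.Ω) :
    UbgMSCoOfRecord F N ν M g K 1 s W = UbgMSCoPOfRecord F N ν M g K 1 s W := by
  rw [UbgMSCoOfRecord_one_of_Omega_empty_of_mem ν M g K s hΩ W hW, UbgMSCoPOfRecord_one_of_Omega_empty ν M g K s hΩ W]

/-- Junction with FILE 16's (1.7)-edition at `Ω₁ = ∅`: where that one returns the datum (`𝐖 0` globally (1.7)-small), the two backgrounds agree.
[cite: Balaban1985RegularSpaces, (1.7) p.77; Balaban1988Convergent, (2.12) p.256] -/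
theorem UbgMSOfRecord_one_eq_UbgMSCoPOfRecord_one_of_Omega_empty (ν : Stage7Numerics) (M : ℕ) (g : ℕ → ℝ) (K : ℕ) (s : SeqOfRecord F ν M g K 1)
    (hΩ : s.Ω 1 = ∅) (W : MSField (F.P K) (SU N)) (hW : PlaqSmall (ν.εreg * (F.P K).eta 0 ^ 2) (W 0)) :
    UbgMSOfRecord F N ν M g K 1 s W = UbgMSCoPOfRecord F N ν M g K 1 s W := by
  rw [UbgMSOfRecord_one_of_Omega_empty ν M g K s hΩ W hW, UbgMSCoPOfRecord_one_of_Omega_empty ν M g K s hΩ W]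

end BackgroundAtAllLarge

/-! ## §4  The ranged data envelope `regSuppPOfRecord` -/

section Envelope

/-- **AT PRINT'S SIGN THE UNIT MULTISCALE CONFIGURATION IS RETAINED** by the ranged envelope: `|1(∂p) − 1| = 0 < cR·ε_j` on the collar and on every `Γ_j`,
`1 ≤ j ≤ k` (FILE 13's `one_mem_regSuppOfRecord` for FILE 22′'s envelope; asked by name by node00-def-T). [cite: Balaban1988Convergent, (1.10) p.248, (2.10) p.256] -/
theorem one_mem_regSuppPOfRecord (ν : Stage7Numerics) (M : ℕ) (g : ℕ → ℝ) (K k : ℕ) {cR : ℝ} (hcR : 0 < cR)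
    (hε : ∀ j, j ≤ k → 0 < epsOfRecord ν g j) (s : SeqOfRecord F ν M g K k) :
    (fun j => (1 : GaugeField (F.P K) j (SU N))) ∈ regSuppPOfRecord F N ν M g K k cR s := by
  have h1 : ∀ (j : ℕ) (q : Plaq (F.P K) j), GaugeField.plaqHol (1 : GaugeField (F.P K) j (SU N)) q = 1 := fun j q => by
    show (1 : SU N) * 1 * (1 : SU N)⁻¹ * (1 : SU N)⁻¹ = 1
    simp
  refine ⟨fun q _ => ?_, fun j _ hjk q _ => ?_⟩
  · rw [h1, GaugeGroup.dist1_one]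
    exact mul_pos hcR (hε 0 (Nat.zero_le k))
  · rw [h1, GaugeGroup.dist1_one]
    exact mul_pos hcR (hε j hjk)

/-- … hence at print's sign the ranged envelope of every sequence is non-empty. [cite: Balaban1988Convergent, (2.10) p.256 (bookkeeping)] -/
theorem regSuppPOfRecord_nonempty (ν : Stage7Numerics) (M : ℕ) (g : ℕ → ℝ) (K k : ℕ) {cR : ℝ} (hcR : 0 < cR)
    (hε : ∀ j, j ≤ k → 0 < epsOfRecord ν g j) (s : SeqOfRecord F ν M g K k) :
    (regSuppPOfRecord F N ν M g K k cR s).Nonempty :=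
  ⟨_, one_mem_regSuppPOfRecord ν M g K k hcR hε s⟩

/-- **AT `Ω₁ = ∅` THE RANGED ENVELOPE OF A LENGTH-1 SEQUENCE IS EVERYTHING**, for any sign of the letter `cR`: the collar `Ω₀(s) ∖ Ω₁ = ∅ ∖ ∅` is empty (§1)
and `Γ₁ = Ω₁^{(1)} = ∅` ((2.2)), so both clauses range over empty plaquette families. [cite: Balaban1988Convergent, (2.2) p.255, (2.10) p.256; Balaban1985Variational, (3) p.278] -/
theorem regSuppPOfRecord_one_eq_univ_of_Omega_empty (ν : Stage7Numerics) (M : ℕ) (g : ℕ → ℝ) (K : ℕ) (cR : ℝ) (s : SeqOfRecord F ν M g K 1)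
    (hΩ : s.Ω 1 = ∅) : regSuppPOfRecord F N ν M g K 1 cR s = Set.univ := by
  refine Set.eq_univ_of_forall fun W => ⟨?_, fun j hj hj1 => ?_⟩
  · rw [suppDomOfRecord_of_Omega_empty F ν K hΩ, hΩ, Set.empty_sdiff, plaqsOf_empty]
    exact plaqSmallOn_empty _ _
  · obtain rfl : j = 1 := le_antisymm hj1 hj
    exact plaqSmallOn_of_genSet_eq_empty F N s (genSet_top_eq_empty s.Ω hΩ) _ _

/-- Membership form: at `Ω₁ = ∅` every retained configuration is in the ranged envelope. [cite: Balaban1988Convergent, (2.10) p.256 (bookkeeping)] -/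
theorem mem_regSuppPOfRecord_one_of_Omega_empty (ν : Stage7Numerics) (M : ℕ) (g : ℕ → ℝ) (K : ℕ) (cR : ℝ) (s : SeqOfRecord F ν M g K 1)
    (hΩ : s.Ω 1 = ∅) (W : MSField (F.P K) (SU N)) : W ∈ regSuppPOfRecord F N ν M g K 1 cR s := by
  rw [regSuppPOfRecord_one_eq_univ_of_Omega_empty ν M g K cR s hΩ]; exact Set.mem_univ W

end Envelope

/-! ## §5  The located degenerate instance `M₁ = 0` of the letter `ν.M₁` (node00-def-P11, pub-ymgap INBOX 2026-08-27 l.18760) -/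

section SideZero

variable (F N)

/-- **THE CUBE FAMILY OF SIDE `0` IS EMPTY** (FILE 1's `cubeIndices`: `range ((n + 0 − 1) ∕ 0) = range 0 = ∅` in every direction).  Print's `M₁` is a
positive integer ([6] (1.3)–(1.6)); this is the located junk corner of the letter, probed by node00-def-P11 (`ProbeEmptySupport`, l.18760).
[cite: Balaban1988Convergent, (2.17) p.257 (typing convention); Balaban1985RegularSpaces, (1.3)–(1.6) p.77] -/
theorem cubeIndices_side_zero (P : Params) : cubeIndices P 0 = ∅ := by
  haveI : Nonempty (Fin P.d) := ⟨⟨0, P.hd⟩⟩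
  unfold cubeIndices
  simp

open Classical in
/-- **AT `M₁ = 0` THE SUPPORT OF RECORD IS EMPTY FOR EVERY SEQUENCE** (no cube of side `0` contributes to `hullD … 0 1 (Ω 1)`): there [15] p. 277 (1)
«Ω₀ ⊇ Ω₁» FAILS, so the instance is outside print (`M₁ ≥ 1`; the record's `θ` has `M₁ ∣ M = L^a` — `Provisos₁₃SepCoP.hM₁`∕`.hM` — whence `M₁ ≠ 0` there: `ne_zero_of_dvd_ne_zero (hM ▸ pow_ne_zero a …) hM₁`).  The v1.5 definitions are NOT edited (frozen edition);
this face only DOCUMENTS the corner — node00-def-P11's guarded facts `…Top7M ∕ …CoP7M` carry the binder `0 < ν.M₁` (at `0 < ν.M₁`, «Ω₀ ⊇ Ω₁» holds by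
`subset_hullD`, `B15Claim189LambdaPin`, not imported here). [cite: Balaban1985Variational, (1) p.277, (3) p.278; Balaban1988Convergent, p.255 (typing convention)] -/
theorem suppDomOfRecord_of_M₁_eq_zero (ν : Stage7Numerics) (hν : ν.M₁ = 0) (K : ℕ) (Ω : ℕ → Set (Site (F.P K) 0)) :
    suppDomOfRecord F ν K Ω = ∅ := by
  rw [suppDomOfRecord_eq, hν]
  refine Set.eq_empty_of_forall_notMem fun x hx => ?_
  unfold hullD at hx
  obtain ⟨a, ha, -⟩ := Set.mem_iUnion₂.1 hx
  have ha0 := (Finset.mem_filter.1 ha).1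
  rw [cubeIndices_side_zero] at ha0
  exact Finset.notMem_empty a ha0

/-- **THE CLASS ON THE EMPTY SUPPORT** keeps only the positive-scale clauses: (1.7) on the plaquettes of `Ω_j` and (1.9) on the bonds of `Ω_j`, `1 ≤ j ≤ k`
— NO clause on the scale-`0` field beyond those. [cite: Balaban1985RegularSpaces, (1.7),(1.9) p.77; Balaban1985Variational, (2),(3) p.278 (bookkeeping)] -/
theorem mem_regMSCoPOfRecordAt_empty_iff (ν : Stage7Numerics) (K k : ℕ) (Ω : ℕ → Set (Site (F.P K) 0)) (U : GaugeField (F.P K) 0 (SU N)) :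
    U ∈ regMSCoPOfRecordAt F N ν K k ∅ Ω ↔
      (∀ j, 1 ≤ j → j ≤ k → PlaqSmallOn (B8Eq17ClassAkV1.plaqsOf (Ω j)) (ν.εreg * (F.P K).eta j ^ 2) U) ∧
        (∀ j, 1 ≤ j → j ≤ k → Sect2.CoDivSmallOn (bondsOf (Ω j)) (ν.εreg * (F.P K).eta j ^ 3) U) := by
  rw [mem_regMSCoPOfRecordAt_iff]
  refine and_congr ⟨fun h j hj1 hjk => ?_, fun h j hjk => ?_⟩ ⟨fun h j hj1 hjk => ?_, fun h j hjk => ?_⟩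
  · have h' := h j hjk
    rwa [topSeq_of_ne_zero _ _ (Nat.one_le_iff_ne_zero.mp hj1)] at h'
  · rcases Nat.eq_zero_or_pos j with rfl | hpos
    · rw [topSeq_zero, plaqsOf_empty]; exact plaqSmallOn_empty _ _
    · rw [topSeq_of_ne_zero _ _ hpos.ne']; exact h j hpos hjk
  · have h' := h j hjk
    rwa [topSeq_of_ne_zero _ _ (Nat.one_le_iff_ne_zero.mp hj1)] at h'
  · rcases Nat.eq_zero_or_pos j with rfl | hpos
    · rw [topSeq_zero, bondsOf_empty]; exact coDivSmallOn_empty _ _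
    · rw [topSeq_of_ne_zero _ _ hpos.ne']; exact h j hpos hjk

/-- **AT `M₁ = 0` THE CLASS OF RECORD IS THE CLASS ON THE EMPTY SUPPORT** — for EVERY length `k` and every sequence it poses no scale-`0` clause beyond the
positive-scale ones (`mem_regMSCoPOfRecordAt_empty_iff`); the located degenerate instance, outside print.
[cite: Balaban1985Variational, (2),(3) p.278; Balaban1988Convergent, (2.12) p.256 (typing convention)] -/
theorem regMSCoPOfRecord_eq_At_empty_of_M₁_eq_zero (ν : Stage7Numerics) (hν : ν.M₁ = 0) (K k : ℕ) (Ω : ℕ → Set (Site (F.P K) 0)) :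
    regMSCoPOfRecord F N ν K k Ω = regMSCoPOfRecordAt F N ν K k ∅ Ω := by
  rw [regMSCoPOfRecord_eq_At, suppDomOfRecord_of_M₁_eq_zero F ν hν K Ω]

/-- Membership form at `M₁ = 0`: the class of record reads only the positive scales. [cite: Balaban1985RegularSpaces, (1.7),(1.9) p.77 (typing convention)] -/
theorem mem_regMSCoPOfRecord_iff_of_M₁_eq_zero (ν : Stage7Numerics) (hν : ν.M₁ = 0) (K k : ℕ) (Ω : ℕ → Set (Site (F.P K) 0))
    (U : GaugeField (F.P K) 0 (SU N)) :
    U ∈ regMSCoPOfRecord F N ν K k Ω ↔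
      (∀ j, 1 ≤ j → j ≤ k → PlaqSmallOn (B8Eq17ClassAkV1.plaqsOf (Ω j)) (ν.εreg * (F.P K).eta j ^ 2) U) ∧
        (∀ j, 1 ≤ j → j ≤ k → Sect2.CoDivSmallOn (bondsOf (Ω j)) (ν.εreg * (F.P K).eta j ^ 3) U) := by
  rw [regMSCoPOfRecord_eq_At_empty_of_M₁_eq_zero F N ν hν K k Ω, mem_regMSCoPOfRecordAt_empty_iff]

/-- **AT `M₁ = 0` THE RANGED ENVELOPE HAS NO COLLAR CLAUSE** (the collar `Ω₀(s) ∖ Ω₁ = ∅ ∖ Ω₁` is empty): only the clauses at the scales `1 … k` remain —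
the scale-`0` data are then read by NO hypothesis of the support edition (the located degenerate instance, outside print).
[cite: Balaban1988Convergent, (1.10) p.248, (2.10) p.256 (typing convention); Balaban1985Variational, (3) p.278] -/
theorem mem_regSuppPOfRecord_iff_of_M₁_eq_zero (ν : Stage7Numerics) (hν : ν.M₁ = 0) (M : ℕ) (g : ℕ → ℝ) (K k : ℕ) (cR : ℝ)
    (s : SeqOfRecord F ν M g K k) (W : MSField (F.P K) (SU N)) :
    W ∈ regSuppPOfRecord F N ν M g K k cR s ↔
      ∀ j, 1 ≤ j → j ≤ k → PlaqSmallOn (B8Eq17ClassAkV1.plaqsOf (genSet s.Ω k j)) (cR * epsOfRecord ν g j) (W j) := by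
  rw [mem_regSuppPOfRecord_iff, suppDomOfRecord_of_M₁_eq_zero F ν hν K s.Ω, Set.empty_sdiff, plaqsOf_empty]
  exact ⟨fun h => h.2, fun h => ⟨plaqSmallOn_empty _ _, h⟩⟩

end SideZero

end Literature.MathematicalPhysics.QuantumFieldTheory.Balaban1983to89.Node00
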